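import Mathlib
import Literature.Analysis.FunctionSpaces.PlancherelL1L2
import HarnessLib

/-!
# A pointwise bound by `‖g‖₂ + ‖Δg‖₂` in the plane (DFI 1995, Prop. 4, support file: the local Sobolev inequality, I)

Topic `Literature/NumberTheory/Sieve`.  Seventh support file of the elementary proof of Proposition 4
of W. Duke, J. B. Friedlander, H. Iwaniec, *Equidistribution of roots of a quadratic congruence to
prime moduli*, Ann. of Math. 141 (1995).  The paper bounds the values of the Poincaré series `P`
through the spectral expansion and the pre-trace formula ((15)–(16), p. 429); our route bounds
`|P(w)|²` by the `L²`-norms of `P` and `ΔP` over a neighbourhood of `w`.  The Euclidean core of that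
local Sobolev inequality is proved here: **for `g ∈ C²_c(ℂ)`,
`|g(z)| ≤ C (‖g‖_{L²} + ‖Δg‖_{L²})`** with an absolute constant (`norm_le_of_laplacian`), by Fourier
analysis: `𝓕(Δg)(ξ) = -4π²|ξ|² 𝓕g(ξ)` (`fourier_laplacian_eq`), so
`(1 + 4π²|ξ|²) 𝓕g = 𝓕(g - Δg)`, whence `𝓕g ∈ L¹` with
`‖𝓕g‖₁ ≤ ‖(1 + 4π²|ξ|²)⁻¹‖₂ ‖g - Δg‖₂` (Cauchy–Schwarz and Plancherel, the tree's
`FunctionSpaces.integral_norm_sq_fourierIntegral_eq`), and `|g(z)| ≤ ‖𝓕g‖₁` by Fourier inversion.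
Everything here is proved (no definition, no named fact).

## References

* W. Duke, J. B. Friedlander, H. Iwaniec, Ann. of Math. (2) 141 (1995), 423–441, §3 (15)–(16).
  [cite: DukeFriedlanderIwaniec1995, (15)–(16) p. 428–429]
* G. B. Folland, *Introduction to Partial Differential Equations*, 2nd ed. (1995), §6.A, Thm. (6.5)
  (the Sobolev lemma `H_s ⊂ C⁰`, `s > n/2`, by the same Fourier argument). [cite: Folland1995PDE, §6.A Thm. (6.5)]
-/

noncomputable section

namespace Literature.NumberTheory.Sieve

open scoped Real _root_.Topology _root_.ENNReal _root_.NNReal FourierTransform Laplacian InnerProductSpace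
open _root_.MeasureTheory _root_.Set _root_.Filter _root_.Complex

namespace DFI1995

/-! ### Compactly supported `C²` functions on `ℂ` -/

/-- The Laplacian of a `C²` function through the orthonormal basis `(1, i)`. [folklore] -/
theorem laplacian_eq_sum_oneI (g : ℂ → ℂ) (x : ℂ) :
    Δ g x = ∑ i : Fin 2, iteratedFDeriv ℝ 2 g x ![Complex.orthonormalBasisOneI i, Complex.orthonormalBasisOneI i] := by
  rw [InnerProductSpace.laplacian_eq_iteratedFDeriv_orthonormalBasis g Complex.orthonormalBasisOneI]

/-- The Laplacian of a compactly supported function is compactly supported. [folklore] -/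
theorem hasCompactSupport_laplacian {g : ℂ → ℂ} (hg : HasCompactSupport g) : HasCompactSupport (Δ g) := by
  have h2 := hg.iteratedFDeriv (𝕜 := ℝ) 2
  refine h2.mono ?_
  intro x hx
  rw [Function.mem_support] at hx ⊢
  intro h0
  apply hx
  rw [laplacian_eq_sum_oneI]
  simp [h0]

/-- The Laplacian of a `C²` function is continuous. [folklore] -/
theorem continuous_laplacian {g : ℂ → ℂ} (hg : ContDiff ℝ 2 g) : Continuous (Δ g) := by
  have hc : Continuous (iteratedFDeriv ℝ 2 g) := hg.continuous_iteratedFDeriv le_rfl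
  have e : Δ g = fun x => ∑ i : Fin 2, iteratedFDeriv ℝ 2 g x
      ![Complex.orthonormalBasisOneI i, Complex.orthonormalBasisOneI i] := funext (laplacian_eq_sum_oneI g)
  rw [e]
  refine continuous_finsetSum _ fun i _ => ?_
  exact (ContinuousMultilinearMap.apply ℝ (fun _ : Fin 2 => ℂ) ℂ
    ![Complex.orthonormalBasisOneI i, Complex.orthonormalBasisOneI i]).continuous.comp hc

/-! ### `𝓕(Δg) = -4π²|ξ|² 𝓕g` -/

/-- **The Fourier transform of the Laplacian**: for `g ∈ C²_c(ℂ)`,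
`𝓕(Δg)(ξ) = -4π² ‖ξ‖² 𝓕g(ξ)`. [cite: Folland1995PDE, §6.A] -/
theorem fourier_laplacian_eq {g : ℂ → ℂ} (hg : ContDiff ℝ 2 g) (hgs : HasCompactSupport g) (ξ : ℂ) :
    𝓕 (Δ g) ξ = -(4 * π ^ 2 * ‖ξ‖ ^ 2 : ℝ) * 𝓕 g ξ := by
  set v := Complex.orthonormalBasisOneI with hv
  -- integrability of the derivatives
  have hint : ∀ n : ℕ, (n : ℕ∞) ≤ 2 → Integrable (iteratedFDeriv ℝ n g) := fun n hn =>
    ((hg.of_le (by exact_mod_cast hn)).continuous_iteratedFDeriv le_rfl).integrable_of_hasCompactSupport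
      (hgs.iteratedFDeriv n)
  have h2 : Integrable (iteratedFDeriv ℝ 2 g) := hint 2 le_rfl
  have hF := Real.fourier_iteratedFDeriv (N := (2 : ℕ∞)) (f := g) (by exact_mod_cast hg) hint (n := 2) le_rfl
  -- `𝓕(Δ g) = ∑ i 𝓕(D² g (v i, v i))`
  have e : Δ g = fun x => ∑ i : Fin 2, iteratedFDeriv ℝ 2 g x ![v i, v i] := funext (laplacian_eq_sum_oneI g)
  have hsum : 𝓕 (Δ g) ξ = ∑ i : Fin 2, 𝓕 (fun x => iteratedFDeriv ℝ 2 g x ![v i, v i]) ξ := by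
    rw [e, Real.fourier_eq]
    simp only [Finset.smul_sum]
    rw [integral_finsetSum]
    · refine Finset.sum_congr rfl fun i _ => ?_
      rw [Real.fourier_eq]
    · intro i _
      have hi : Integrable (fun x => iteratedFDeriv ℝ 2 g x ![v i, v i]) :=
        (ContinuousMultilinearMap.apply ℝ (fun _ : Fin 2 => ℂ) ℂ ![v i, v i]).integrable_comp h2
      exact (Real.fourierIntegral_convergent_iff ξ).2 hi
  rw [hsum]
  have hterm : ∀ i : Fin 2, 𝓕 (fun x => iteratedFDeriv ℝ 2 g x ![v i, v i]) ξ =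
      (-(2 * π * Complex.I)) ^ 2 * ((⟪ξ, v i⟫_ℝ) ^ 2 : ℝ) * 𝓕 g ξ := by
    intro i
    rw [← Real.fourier_continuousMultilinearMap_apply h2, hF, VectorFourier.fourierPowSMulRight_apply]
    simp only [Fin.prod_univ_two, Matrix.cons_val_zero, Matrix.cons_val_one, neg_apply,
      Complex.real_smul, smul_eq_mul, neg_mul_neg]
    have hx : ((innerSL ℝ) ξ) (v i) = ⟪ξ, v i⟫_ℝ := rfl
    rw [hx]
    push_cast
    ring
  simp_rw [hterm]
  rw [← Finset.sum_mul, ← Finset.mul_sum]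
  have hpar : ∑ i : Fin 2, ((⟪ξ, v i⟫_ℝ) ^ 2 : ℝ) = ‖ξ‖ ^ 2 := by
    rw [← v.sum_sq_inner_right ξ]
    refine Finset.sum_congr rfl fun i _ => ?_
    rw [real_inner_comm]
  rw [← Complex.ofReal_sum] at *
  push_cast
  rw [show (∑ i : Fin 2, ((⟪ξ, v i⟫_ℝ : ℝ) : ℂ) ^ 2) = ((‖ξ‖ ^ 2 : ℝ) : ℂ) by
    rw [← hpar]; push_cast; rfl]
  have hI : Complex.I ^ 2 = -1 := Complex.I_sq
  push_cast
  linear_combination (4 * (π : ℂ) ^ 2 * ((‖ξ‖ : ℂ) ^ 2) * 𝓕 g ξ) * hI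

/-! ### The weight `(1 + 4π²|ξ|²)⁻¹` -/

/-- `(1 + 4π²‖ξ‖²)⁻²` is integrable on `ℂ` (dimension `2 < 4`). [folklore] -/
theorem integrable_weight_sq :
    Integrable (fun ξ : ℂ => ((1 + 4 * π ^ 2 * ‖ξ‖ ^ 2)⁻¹) ^ 2) (volume : Measure ℂ) := by
  have h4 : Integrable (fun ξ : ℂ => (1 + ‖ξ‖) ^ (-(4 : ℝ))) (volume : Measure ℂ) :=
    integrable_one_add_norm (by rw [Complex.finrank_real_complex]; norm_num)
  refine (h4.const_mul 4).mono' ?_ (Eventually.of_forall fun ξ => ?_)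
  · refine (Measurable.pow_const (Measurable.inv ?_) 2).aestronglyMeasurable
    exact measurable_const.add (measurable_const.mul (measurable_norm.pow_const 2))
  · have hπ : (1 : ℝ) ≤ 4 * π ^ 2 := by nlinarith [Real.pi_gt_three]
    have hn : 0 ≤ ‖ξ‖ := norm_nonneg ξ
    have h1 : 0 < 1 + 4 * π ^ 2 * ‖ξ‖ ^ 2 := by positivity
    have h2 : (1 + ‖ξ‖) ^ 2 ≤ 2 * (1 + 4 * π ^ 2 * ‖ξ‖ ^ 2) := by nlinarith [sq_nonneg (1 - ‖ξ‖)]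
    have e4 : (1 + ‖ξ‖) ^ (4 : ℝ) = (1 + ‖ξ‖) ^ (4 : ℕ) := by
      exact_mod_cast Real.rpow_natCast (1 + ‖ξ‖) 4
    rw [Real.norm_of_nonneg (by positivity), Real.rpow_neg (by positivity), e4, inv_pow,
      inv_eq_one_div, inv_eq_one_div, mul_one_div, div_le_div_iff₀ (by positivity) (by positivity)]
    have h3 : ((1 + ‖ξ‖) ^ 2) ^ 2 ≤ (2 * (1 + 4 * π ^ 2 * ‖ξ‖ ^ 2)) ^ 2 :=
      pow_le_pow_left₀ (by positivity) h2 2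
    nlinarith [h3]

/-! ### The pointwise bound -/

/-- `𝓕(g - Δg)(ξ) = (1 + 4π²|ξ|²) 𝓕g(ξ)` for `g ∈ C²_c`. [folklore] -/
theorem fourier_sub_laplacian_eq {g : ℂ → ℂ} (hg : ContDiff ℝ 2 g) (hgs : HasCompactSupport g) (ξ : ℂ) :
    𝓕 (fun x => g x - Δ g x) ξ = ((1 + 4 * π ^ 2 * ‖ξ‖ ^ 2 : ℝ) : ℂ) * 𝓕 g ξ := by
  have hgi : Integrable g := hg.continuous.integrable_of_hasCompactSupport hgs
  have hΔi : Integrable (Δ g) := (continuous_laplacian hg).integrable_of_hasCompactSupport (hasCompactSupport_laplacian hgs)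
  have h1 : 𝓕 (fun x => g x - Δ g x) ξ = 𝓕 g ξ - 𝓕 (Δ g) ξ := by
    rw [Real.fourier_eq, Real.fourier_eq, Real.fourier_eq, ← integral_sub]
    · simp only [smul_sub]
    · exact (Real.fourierIntegral_convergent_iff ξ).2 hgi
    · exact (Real.fourierIntegral_convergent_iff ξ).2 hΔi
  rw [h1, fourier_laplacian_eq hg hgs ξ]
  push_cast
  ring

/-- **The planar Sobolev bound**: there is an absolute `C` with
`|g(z)| ≤ C (‖g‖_{L²} + ‖Δg‖_{L²})` for every `g ∈ C²_c(ℂ)` and every `z`.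
[cite: Folland1995PDE, §6.A Thm. (6.5)] -/
theorem norm_le_of_laplacian :
    ∃ C : ℝ, 0 ≤ C ∧ ∀ g : ℂ → ℂ, ContDiff ℝ 2 g → HasCompactSupport g → ∀ z : ℂ,
      ‖g z‖ ≤ C * (Real.sqrt (∫ x, ‖g x‖ ^ 2) + Real.sqrt (∫ x, ‖Δ g x‖ ^ 2)) := by
  set W : ℂ → ℝ := fun ξ => (1 + 4 * π ^ 2 * ‖ξ‖ ^ 2)⁻¹ with hW
  have hWpos : ∀ ξ, 0 < W ξ := fun ξ => by simp only [hW]; positivity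
  have hWle : ∀ ξ, W ξ ≤ 1 := fun ξ => by
    simp only [hW]
    apply inv_le_one_of_one_le₀
    nlinarith [sq_nonneg (π * ‖ξ‖)]
  have hWc : Continuous W := by
    refine Continuous.inv₀ (by fun_prop) fun ξ => ?_
    positivity
  have hW2 : Integrable (fun ξ => W ξ ^ 2) (volume : Measure ℂ) := integrable_weight_sq
  set C₁ : ℝ := Real.sqrt (∫ ξ, W ξ ^ 2) with hC₁
  refine ⟨Real.sqrt 2 * C₁, by positivity, fun g hg hgs z => ?_⟩
  -- the functions `g`, `Δ g`, `h = g - Δ g`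
  have hgc : Continuous g := hg.continuous
  have hgi : Integrable g := hgc.integrable_of_hasCompactSupport hgs
  have hΔc : Continuous (Δ g) := continuous_laplacian hg
  have hΔs : HasCompactSupport (Δ g) := hasCompactSupport_laplacian hgs
  set h : ℂ → ℂ := fun x => g x - Δ g x with hh
  have hhc : Continuous h := hgc.sub hΔc
  have hhs : HasCompactSupport h := hgs.sub hΔs
  have hhi : Integrable h := hhc.integrable_of_hasCompactSupport hhs
  have hh2 : MemLp h 2 (volume : Measure ℂ) := hhc.memLp_of_hasCompactSupport hhs
  -- Plancherel for `h`
  have hFh2 : MemLp (𝓕 h) 2 (volume : Measure ℂ) :=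
    Literature.Analysis.FunctionSpaces.memLp_two_fourierIntegral hhi hh2
  have hPl : ∫ ξ, ‖𝓕 h ξ‖ ^ 2 = ∫ x, ‖h x‖ ^ 2 :=
    Literature.Analysis.FunctionSpaces.integral_norm_sq_fourierIntegral_eq hhi hh2
  -- `𝓕 g = W · 𝓕 h`
  have hFg : ∀ ξ, 𝓕 g ξ = ((W ξ : ℝ) : ℂ) * 𝓕 h ξ := by
    intro ξ
    have e := fourier_sub_laplacian_eq hg hgs ξ
    change 𝓕 h ξ = _ at e
    have h1 : (0 : ℝ) < 1 + 4 * π ^ 2 * ‖ξ‖ ^ 2 := by positivity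
    have e2 : ((W ξ : ℝ) : ℂ) * ((1 + 4 * π ^ 2 * ‖ξ‖ ^ 2 : ℝ) : ℂ) = 1 := by
      rw [← Complex.ofReal_mul, ← Complex.ofReal_one, Complex.ofReal_inj]
      exact inv_mul_cancel₀ h1.ne'
    rw [e, ← mul_assoc, e2, one_mul]
  -- `𝓕 g ∈ L¹` with `∫ ‖𝓕 g‖ ≤ C₁ ‖h‖₂`
  have hWm : MemLp (fun ξ => ((W ξ : ℝ) : ℂ)) 2 (volume : Measure ℂ) := by
    refine (memLp_two_iff_integrable_sq_norm (Complex.continuous_ofReal.comp hWc).aestronglyMeasurable).2 ?_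
    refine hW2.congr (Eventually.of_forall fun ξ => ?_)
    simp [Real.norm_of_nonneg (hWpos ξ).le]
  have hprod : Integrable (fun ξ => ((W ξ : ℝ) : ℂ) * 𝓕 h ξ) (volume : Measure ℂ) :=
    hWm.integrable_mul hFh2
  have hFgi : Integrable (𝓕 g) (volume : Measure ℂ) := hprod.congr (Eventually.of_forall fun ξ => (hFg ξ).symm)
  have hL1 : ∫ ξ, ‖𝓕 g ξ‖ ≤ C₁ * Real.sqrt (∫ x, ‖h x‖ ^ 2) := by
    have e1 : ∀ ξ, ‖𝓕 g ξ‖ = W ξ * ‖𝓕 h ξ‖ := fun ξ => by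
      rw [hFg ξ, norm_mul, Complex.norm_real, Real.norm_of_nonneg (hWpos ξ).le]
    simp_rw [e1]
    have hCS := integral_mul_le_Lp_mul_Lq_of_nonneg (μ := (volume : Measure ℂ)) Real.HolderConjugate.two_two
      (Eventually.of_forall fun ξ => (hWpos ξ).le) (Eventually.of_forall fun ξ => norm_nonneg (𝓕 h ξ))
      (by rw [show ENNReal.ofReal 2 = 2 by norm_num]
          exact (memLp_two_iff_integrable_sq hWc.aestronglyMeasurable).2 hW2)
      (by rw [show ENNReal.ofReal 2 = 2 by norm_num]; exact hFh2.norm)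
    refine hCS.trans (le_of_eq ?_)
    simp only [Real.rpow_two]
    rw [hPl, hC₁, Real.sqrt_eq_rpow, Real.sqrt_eq_rpow]
  -- Fourier inversion: `|g z| ≤ ∫ ‖𝓕 g‖`
  have hinv : g z = 𝓕⁻ (𝓕 g) z := by rw [hgc.fourierInv_fourier_eq hgi hFgi]
  have hpt : ‖g z‖ ≤ ∫ ξ, ‖𝓕 g ξ‖ := by
    rw [hinv, Real.fourierInv_eq]
    refine (norm_integral_le_integral_norm _).trans (le_of_eq ?_)
    refine integral_congr_ae (Eventually.of_forall fun ξ => ?_)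
    simp only [Circle.norm_smul]
  -- `‖h‖₂ ≤ √2 (‖g‖₂ + ‖Δg‖₂)`
  have hg2i : Integrable (fun x => ‖g x‖ ^ 2) (volume : Measure ℂ) :=
    (memLp_two_iff_integrable_sq_norm hgc.aestronglyMeasurable).1 (hgc.memLp_of_hasCompactSupport hgs)
  have hΔ2i : Integrable (fun x => ‖Δ g x‖ ^ 2) (volume : Measure ℂ) :=
    (memLp_two_iff_integrable_sq_norm hΔc.aestronglyMeasurable).1 (hΔc.memLp_of_hasCompactSupport hΔs)
  have hh2le : ∫ x, ‖h x‖ ^ 2 ≤ 2 * (∫ x, ‖g x‖ ^ 2) + 2 * (∫ x, ‖Δ g x‖ ^ 2) := by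
    rw [← integral_const_mul, ← integral_const_mul, ← integral_add (hg2i.const_mul 2) (hΔ2i.const_mul 2)]
    refine integral_mono_of_nonneg (Eventually.of_forall fun x => sq_nonneg _)
      ((hg2i.const_mul 2).add (hΔ2i.const_mul 2)) (Eventually.of_forall fun x => ?_)
    have := norm_sub_le (g x) (Δ g x)
    have h3 : ‖g x - Δ g x‖ ^ 2 ≤ (‖g x‖ + ‖Δ g x‖) ^ 2 := pow_le_pow_left₀ (norm_nonneg _) this 2
    simp only [hh]
    nlinarith [h3, sq_nonneg (‖g x‖ - ‖Δ g x‖)]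
  have hg20 : 0 ≤ ∫ x, ‖g x‖ ^ 2 := integral_nonneg fun x => sq_nonneg _
  have hΔ20 : 0 ≤ ∫ x, ‖Δ g x‖ ^ 2 := integral_nonneg fun x => sq_nonneg _
  have hsqrt : Real.sqrt (∫ x, ‖h x‖ ^ 2) ≤
      Real.sqrt 2 * (Real.sqrt (∫ x, ‖g x‖ ^ 2) + Real.sqrt (∫ x, ‖Δ g x‖ ^ 2)) := by
    calc Real.sqrt (∫ x, ‖h x‖ ^ 2) ≤ Real.sqrt (2 * (∫ x, ‖g x‖ ^ 2) + 2 * (∫ x, ‖Δ g x‖ ^ 2)) :=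
          Real.sqrt_le_sqrt hh2le
      _ ≤ Real.sqrt (2 * ∫ x, ‖g x‖ ^ 2) + Real.sqrt (2 * ∫ x, ‖Δ g x‖ ^ 2) := by
          -- `√(x + y) ≤ √x + √y` (cf. `MRT2015.sqrt_add_le_sqrt_add_sqrt`)
          rw [Real.sqrt_le_left (by positivity)]
          nlinarith [Real.sq_sqrt (by positivity : (0 : ℝ) ≤ 2 * ∫ x, ‖g x‖ ^ 2),
            Real.sq_sqrt (by positivity : (0 : ℝ) ≤ 2 * ∫ x, ‖Δ g x‖ ^ 2),
            mul_nonneg (Real.sqrt_nonneg (2 * ∫ x, ‖g x‖ ^ 2)) (Real.sqrt_nonneg (2 * ∫ x, ‖Δ g x‖ ^ 2))]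
      _ = Real.sqrt 2 * (Real.sqrt (∫ x, ‖g x‖ ^ 2) + Real.sqrt (∫ x, ‖Δ g x‖ ^ 2)) := by
          rw [Real.sqrt_mul (by norm_num), Real.sqrt_mul (by norm_num)]; ring
  have hC₁0 : 0 ≤ C₁ := Real.sqrt_nonneg _
  calc ‖g z‖ ≤ ∫ ξ, ‖𝓕 g ξ‖ := hpt
    _ ≤ C₁ * Real.sqrt (∫ x, ‖h x‖ ^ 2) := hL1
    _ ≤ C₁ * (Real.sqrt 2 * (Real.sqrt (∫ x, ‖g x‖ ^ 2) + Real.sqrt (∫ x, ‖Δ g x‖ ^ 2))) :=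
        mul_le_mul_of_nonneg_left hsqrt hC₁0
    _ = Real.sqrt 2 * C₁ * (Real.sqrt (∫ x, ‖g x‖ ^ 2) + Real.sqrt (∫ x, ‖Δ g x‖ ^ 2)) := by ring

end DFI1995

end Literature.NumberTheory.Sieve
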